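import Literature.NumberTheory.Automorphic.HeckeAlgebraStructureConstants   -- ★ Andrianov L. 1.5 ∕ Shimura (3.1.1): `doubleCosetCoeff_doubleCosetOperator_mul`, `card_pairs_eq_card_inv_mul_mem`
import HarnessLib

/-!
# R90 · S6 «Ch. 14.1–14.5 stable TF» — WAVE 10 card W10-f (H.0): STRUCTURE CONSTANTS OF A HECKE PAIR, TRANSVERSAL-FREE, AND THE
# SUPPORT-RESTRICTED EXPANSION IN THE DOUBLE-COSET BASIS (`Theorems/R90S6HeckeProductCoordinates.lean`; row E1.4.4.2.3, algebra half)

Cell `hodgecm-mathlib`, crux H413 (`stmt-HodgeConjecture-24833`), route of record `HCCMUnconditional`; programme R90-TF, section S6 (base `R90-C14`),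
seat R90-C14-p06 (g0); S6 dealer R90-C14-plan (g2) CARD W10-f (R90 bus 2026-09-05T00:45:01Z) + RULING R1 (00:49:11Z: «the individual coefficients are ON
PATH … p06 = (H.0) the algebra-level PRODUCT FORMULA … specialised from ★ `doubleCosetCoeff_doubleCosetOperator_mul`, junction letters agreed with p10»);
JUNCTION with R90-C14-p10 (g0) SETTLED (R90 bus 01:00Z offer ∕ 01:03:39Z «=»): the count letter of the Pieri layer is
`pieriCount r μ λ := #{γ ∈ K₀·t_rK₀ ∕ K₀ : γ̃⁻¹ ϖ^λ ∈ K₀ ϖ^μ K₀}` — EXACTLY the right-hand side of (H.0) below at `(g, g′, h) = (ϖ^μ, t_r, ϖ^λ)`; p10's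
`Theorems/R90S6GLThreePieriCounts.lean` computes it.  This file is the GENERIC algebra half (any Hecke pair `(G, K)`, any commutative `k`); the `GL₃`
element-level Pieri formulas (H.1)(H.2) and the `b`-recursion (H.3)(H.4) follow in `Theorems/R90S6GLThreePieri.lean` ∕ `…BCPartnerCartanRecursion.lean` once
p10's counts are ★.  Lane `--supports stmt-HodgeConjecture-24833 --as helper`; THEOREMS ONLY (no definition, no instance, no notation, no named fact, no `sorry`);
imports = ★ `HeckeAlgebraStructureConstants` + HarnessLib.

* **`doubleCosetCoeff_mul_eq_ncard`** — (H.0): the coordinate of `T_g T_{g′}` at `KhK` is `#{γ ∈ K·g′K ∕ K : γ̃⁻¹ h ∈ KgK}` (Shimura's coset form of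
  Andrianov's `c(g, g′; h)`, read on the ORBIT instead of a chosen transversal; `γ̃ = γ.out`, the choice is immaterial — `out_inv_mul_mem_orbit_iff`);
* **`eq_sum_doubleCosetCoeff_smul_doubleCosetOperator`** — (H.0b): if the double cosets `KxK`, `x ∈ S`, are pairwise distinct and carry every non-zero
  coordinate of `T`, then `T = Σ_{x ∈ S} (coordinate of T at KxK) • T_x` (★ basis `Module.Basis.ofRepr (doubleCosetCoeffEquiv K)`, ★
  `ofRepr_doubleCosetCoeffEquiv_apply`) — the form in which a product with ≤ 3 non-zero coordinates becomes a 3-term identity.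

HONEST LABEL: Hecke-algebra bookkeeping, count-neutral until E1.4.4.2.3 consumes the Pieri layer; HC_CM is proved only modulo the 7 printed citations (2 remaining
named inputs: hLiu418 = stmt-HodgeConjecture-24832, h413 = stmt-HodgeConjecture-24833) until rung 0 closes; REL ≠ ★ ≠ BUILT.

## References
* [AndrianovZhuravlev2015] A. N. Andrianov, V. G. Zhuravlev, *Modular Forms and Hecke Operators*, Ch. 3 §1.1 Lemma 1.5 (PDF pp. 98–99).
* [ShimuraIATAF1971] G. Shimura, *Introduction to the Arithmetic Theory of Automorphic Functions* (1971), §3.1 (3.1.1), Prop. 3.1–3.2 (PDF pp. 69–71).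
-/

set_option autoImplicit false
-- the mandated namespace repeats the single-problem summit's segment (`HodgeConjecture.HodgeConjecture`)
set_option linter.dupNamespace false

noncomputable section

open MulAction
open Literature.NumberTheory.Automorphic

namespace Summit.HodgeConjecture.HodgeConjecture.R90.S6

variable {k G : Type*} [CommRing k] [Group G] (K : Subgroup G) [IsHeckeTriple (⊤ : Submonoid G) K K]

/-- A finite transversal of `KgK ∕ K` (Shimura Prop. 3.1; re-derived, as in ★ `HeckeAlgebraStructureConstants` §0). [folklore] -/
private theorem exists_transversal' (g : G) :
    ∃ s : Finset G, Set.BijOn (fun x : G => (x : G ⧸ K)) s (orbit K (g : G ⧸ K)) := by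
  classical
  obtain ⟨t, ht⟩ := (finite_orbit_quotient K g).exists_finset_coe
  refine ⟨t.image Quotient.out, ?_, ?_, ?_⟩
  · intro x hx
    obtain ⟨y, hy, rfl⟩ := Finset.mem_image.1 hx
    change ((y.out : G) : G ⧸ K) ∈ orbit K (g : G ⧸ K)
    rw [QuotientGroup.out_eq', ← ht]
    exact hy
  · intro x hx x' hx' h
    obtain ⟨y, -, rfl⟩ := Finset.mem_image.1 hx
    obtain ⟨y', -, rfl⟩ := Finset.mem_image.1 hx'
    change ((y.out : G) : G ⧸ K) = ((y'.out : G) : G ⧸ K) at h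
    rw [QuotientGroup.out_eq', QuotientGroup.out_eq'] at h
    rw [h]
  · intro y hy
    rw [← ht] at hy
    exact ⟨y.out, Finset.mem_image.2 ⟨y, hy, rfl⟩, QuotientGroup.out_eq' y⟩

omit [IsHeckeTriple (⊤ : Submonoid G) K K] in
/-- `σ⁻¹ h K ∈ K · gK` only depends on the coset `σK`: for `γ = σK`, `γ.out⁻¹ h K ∈ K · gK ↔ σ⁻¹ h K ∈ K · gK`. [folklore] -/
private theorem out_inv_mul_mem_orbit_iff (g h σ : G) :
    ((((σ : G ⧸ K).out)⁻¹ * h : G) : G ⧸ K) ∈ orbit K (g : G ⧸ K) ↔ ((σ⁻¹ * h : G) : G ⧸ K) ∈ orbit K (g : G ⧸ K) := by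
  obtain ⟨κ, hκ⟩ := QuotientGroup.mk_out_eq_mul K σ
  have hout : ((σ : G ⧸ K).out)⁻¹ * h = (κ : G)⁻¹ * (σ⁻¹ * h) := by
    rw [hκ, mul_inv_rev, mul_assoc]
  rw [hout]
  constructor
  · intro hmem
    have := MulAction.mem_orbit_of_mem_orbit κ hmem
    rwa [subgroup_smul_mk, ← mul_assoc, mul_inv_cancel, one_mul] at this
  · intro hmem
    have := MulAction.mem_orbit_of_mem_orbit κ⁻¹ hmem
    rwa [subgroup_smul_mk, Subgroup.coe_inv] at this

/-- **(H.0) THE STRUCTURE CONSTANTS OF A HECKE PAIR, TRANSVERSAL-FREE**: the coordinate of `T_g T_{g'}` at the double coset `KhK` is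
`#{γ ∈ K·g'K ∕ K : γ̃⁻¹ h ∈ K g K}` (Shimura's coset form of Andrianov's `c(g, g'; h)`, ★ `doubleCosetCoeff_doubleCosetOperator_mul` +
★ `card_pairs_eq_card_inv_mul_mem`, read on the orbit itself instead of a chosen transversal). [cite: ShimuraIATAF1971, §3.1 (3.1.1)]
[cite: AndrianovZhuravlev2015, Ch. 3 §1.1 Lemma 1.5] -/
theorem doubleCosetCoeff_mul_eq_ncard (g g' h : G) :
    heckeAlgebra.doubleCosetCoeff K (heckeAlgebra.doubleCosetOperator (k := k) K g * heckeAlgebra.doubleCosetOperator K g')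
        (HeckeCoset.mk K K ⟨h, Submonoid.mem_top h⟩) =
      (({γ ∈ orbit K (g' : G ⧸ K) | ((γ.out⁻¹ * h : G) : G ⧸ K) ∈ orbit K (g : G ⧸ K)}).ncard : k) := by
  classical
  obtain ⟨s, hs⟩ := exists_transversal' K g
  obtain ⟨s', hs'⟩ := exists_transversal' K g'
  rw [heckeAlgebra.doubleCosetCoeff_doubleCosetOperator_mul K g g' h hs hs', heckeAlgebra.card_pairs_eq_card_inv_mul_mem K g h s' hs]
  congr 1
  -- the filtered transversal maps bijectively onto the filtered orbit
  rw [← Set.ncard_coe_finset, ← (hs'.injOn.mono (s₁ := ((s'.filter fun σ : G => ((σ⁻¹ * h : G) : G ⧸ K) ∈ orbit K (g : G ⧸ K)) : Set G))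
    (by intro x hx; exact (Finset.mem_filter.1 (Finset.mem_coe.1 hx)).1)).ncard_image]
  congr 1
  ext γ
  simp only [Set.mem_image, Finset.coe_filter, Set.mem_setOf_eq]
  constructor
  · rintro ⟨σ, ⟨hσ, hσh⟩, rfl⟩
    exact ⟨hs'.mapsTo hσ, (out_inv_mul_mem_orbit_iff K g h σ).2 hσh⟩
  · rintro ⟨hγ, hγh⟩
    obtain ⟨σ, hσ, rfl⟩ := hs'.surjOn hγ
    exact ⟨σ, ⟨hσ, (out_inv_mul_mem_orbit_iff K g h σ).1 hγh⟩, rfl⟩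

/-- **(H.0b) SUPPORT-RESTRICTED EXPANSION in the double-coset basis**: if the cosets `KxK`, `x ∈ S`, are pairwise distinct and every double coset carrying a
non-zero coordinate of `T` is one of them, then `T = Σ_{x ∈ S} (coordinate of T at KxK) • T_x` (★ basis `Module.Basis.ofRepr (doubleCosetCoeffEquiv K)`,
★ `ofRepr_doubleCosetCoeffEquiv_apply`). [cite: AndrianovZhuravlev2015, Ch. 3 §1.1 Lemma 1.5] -/
theorem eq_sum_doubleCosetCoeff_smul_doubleCosetOperator (T : heckeAlgebra k G K) (S : Finset G)
    (hinj : Set.InjOn (fun x : G => HeckeCoset.mk K K ⟨x, Submonoid.mem_top x⟩) S)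
    (hsupp : ∀ D, heckeAlgebra.doubleCosetCoeff K T D ≠ 0 → ∃ x ∈ S, HeckeCoset.mk K K ⟨x, Submonoid.mem_top x⟩ = D) :
    T = ∑ x ∈ S, heckeAlgebra.doubleCosetCoeff K T (HeckeCoset.mk K K ⟨x, Submonoid.mem_top x⟩) • heckeAlgebra.doubleCosetOperator K x := by
  classical
  set bs := Module.Basis.ofRepr (heckeAlgebra.doubleCosetCoeffEquiv (k := k) K) with hbs
  have hrepr : ∀ D, bs.repr T D = heckeAlgebra.doubleCosetCoeff K T D := fun D => rfl
  have hsub : (bs.repr T).support ⊆ S.image fun x : G => HeckeCoset.mk K K ⟨x, Submonoid.mem_top x⟩ := fun D hD => by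
    obtain ⟨x, hx, rfl⟩ := hsupp D (by rw [← hrepr]; exact Finsupp.mem_support_iff.1 hD)
    exact Finset.mem_image_of_mem _ hx
  conv_lhs => rw [← bs.linearCombination_repr T, Finsupp.linearCombination_apply,
    Finsupp.sum_of_support_subset (bs.repr T) hsub (fun D a => a • bs D) (fun D _ => zero_smul k (bs D))]
  rw [Finset.sum_image hinj]
  refine Finset.sum_congr rfl fun x _ => ?_
  rw [hrepr, hbs, heckeAlgebra.ofRepr_doubleCosetCoeffEquiv_apply]

end Summit.HodgeConjecture.HodgeConjecture.R90.S6

end
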